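import Summits.Ventures.CertifiedManyBodySolver.Upper.BlochDressedQFCertificate
import HarnessLib

/-!
# Ventures/CertifiedManyBodySolver — Upper/BlochDressedCornerHarmonicsTTPrime.lean

HONEST FRAMING: first certified bounds; not a superconductivity verdict; every number certified or labelled float.

THE CORNER WINDOWS IN HARMONICS (hubbard-fast-atlas-2; step F(i) of the `t–t'` twin of the chain `Upper/BlochDressed*.lean`;
theorem-only, nothing is claimed).
The cell-form bound `energyDensityTT'_le_dressedCell` reads the Bloch reference through harmonics `|k|⁻¹ Σ_κ χ_κ(u) Q σ κ` with
`u ∈ {0, ±e_j}` (plaquette and axial-link windows, as at `t' = 0`) and, for the CORNER windows, `u ∈ {0, ±1}²` (cell-crossing vectors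
of the diagonal plaquette pairs); for a finitely supported certified kernel these are the kernel entries `γ_σ(-u)` (`harmonic_kernelBlock`):
* `cornerWindow_zero_eq_harmonics`, `cornerWindow_one_eq_harmonics` — the corner windows written with a harmonic family `Γ σ u`;
The thermodynamic limit and the certificate theorem are the next file `Upper/BlochDressedQFCertificateTTPrime.lean`.
Sources: Lieb 1981 [Lieb1981]; Bach–Lieb–Solovej 1994 (2c.36), (3a.2) [BachLiebSolovej1994]. Everything proved; no definition.
-/

noncomputable section

namespace Summit.Ventures.CertifiedManyBodySolver.Upper

open Matrix Finset Filter
open Literature.MathematicalPhysics.QuantumLattice Literature.MathematicalPhysics.QuantumLattice.HartreeFock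
  Literature.MathematicalPhysics.QuantumLattice.ThermodynamicLimit HeisenbergTL HubbardWave0 PlaquetteLUC
open scoped ComplexOrder ComplexConjugate Topology

section Harmonics

variable {M : Fin 2 → ℕ} [∀ i, NeZero (M i)] {q : Fin 2 → ℕ} {k : Fin 2 → ℕ} [∀ i, NeZero (k i)]

omit [∀ i, NeZero (M i)] [∀ i, NeZero (k i)] in
/-- `cellVec` is additive. [folklore] -/
theorem cellVec_add' (R T : Fin 2 → ℤ) : cellVec k (R + T) = cellVec k R + cellVec k T := by
  funext i; simp [cellVec]

omit [∀ i, NeZero (M i)] [∀ i, NeZero (k i)] in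
/-- `cellVec` commutes with subtraction. [folklore] -/
theorem cellVec_sub' (R T : Fin 2 → ℤ) : cellVec k (R - T) = cellVec k R - cellVec k T := by
  funext i; simp [cellVec]

omit [∀ i, NeZero (M i)] [∀ i, NeZero (k i)] in
/-- `cellVec k 0 = 0`. [folklore] -/
theorem cellVec_zero' : cellVec k (0 : Fin 2 → ℤ) = 0 := by
  funext i; simp [cellVec]

omit [∀ i, NeZero (M i)] [∀ i, NeZero (k i)] in
/-- A face vector `[face] e_j` of the torus of cells is the cast of the same integer vector. [folklore] -/
theorem ite_single_eq_cellVec (c : Prop) [Decidable c] (j : Fin 2) :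
    (if c then (0 : RectTorusSite k) else Pi.single j 1) = cellVec k (if c then (0 : Fin 2 → ℤ) else Pi.single j 1) := by
  split_ifs
  · rw [cellVec_zero']
  · rw [cellVec_single']

omit [∀ i, NeZero (M i)] [∀ i, NeZero (k i)] in
/-- Components of a face vector are `0` or `1`. [folklore] -/
theorem ite_single_apply_zero_or_one (c : Prop) [Decidable c] (j i : Fin 2) :
    (if c then (0 : Fin 2 → ℤ) else Pi.single j 1) i = 0 ∨ (if c then (0 : Fin 2 → ℤ) else Pi.single j 1) i = 1 := by
  split_ifs
  · exact Or.inl rfl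
  · by_cases h : i = j
    · subst h; exact Or.inr (by simp)
    · exact Or.inl (by simp [h])

omit [∀ i, NeZero (M i)] [∀ i, NeZero (k i)] in
/-- Differences of `{0,1}`-vectors have components in `{0, ±1}`. [folklore] -/
theorem sub_apply_mem_of_zero_one {z z' : Fin 2 → ℤ} (hz : ∀ i, z i = 0 ∨ z i = 1) (hz' : ∀ i, z' i = 0 ∨ z' i = 1) (i : Fin 2) :
    (z - z') i = 0 ∨ (z - z') i = 1 ∨ (z - z') i = -1 := by
  rw [Pi.sub_apply]
  rcases hz i with h | h <;> rcases hz' i with h' | h' <;> simp [h, h']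

omit [∀ i, NeZero (M i)] in
/-- **The corner window of kind `0` in harmonics**: with `Γ σ u = |k|⁻¹ Σ_κ χ_κ(u) Q σ κ` for `u ∈ {0,±1}²`, the window
`W₁₆` of `Upper/BlochDressedCornerWindowsTTPrime.lean` has entries `Γ σ (z(o) − z(o'))`, `z` the integer cell-crossing vector of the copy.
[cite: BachLiebSolovej1994, eq. (3a.2)] -/
theorem cornerWindow_zero_eq_harmonics
    (Q : Fin 2 → RectTorusSite k → Matrix (RectTorusSite M) (RectTorusSite M) ℂ)
    (Γ : Fin 2 → (Fin 2 → ℤ) → Matrix (RectTorusSite M) (RectTorusSite M) ℂ)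
    (hΓ : ∀ σ (u : Fin 2 → ℤ), (∀ j, u j = 0 ∨ u j = 1 ∨ u j = -1) → ∀ p p',
      ((Fintype.card (RectTorusSite k) : ℂ))⁻¹ * ∑ κ, blockChar κ (cellVec k u) * Q σ κ p p' = Γ σ u p p')
    (r : (i : Fin 2) → Fin (q i)) :
    (Matrix.of fun o o' : Orb (Fin 2 ×ₗ FermionTorus 2 2) => if (ofLex o).2 = (ofLex o').2 then
              ((Fintype.card (RectTorusSite k) : ℂ))⁻¹ * ∑ κ, blockChar κ
                ((if (ofLex (ofLex o).1).1 = 0 then (0 : RectTorusSite k) else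
                    ((if (r 0 : ℕ) + 1 < q 0 then 0 else Pi.single 0 1) + (if (r 1 : ℕ) + 1 < q 1 then 0 else Pi.single 1 1))) -
                  (if (ofLex (ofLex o').1).1 = 0 then (0 : RectTorusSite k) else
                    ((if (r 0 : ℕ) + 1 < q 0 then 0 else Pi.single 0 1) + (if (r 1 : ℕ) + 1 < q 1 then 0 else Pi.single 1 1)))) *
                Q (ofLex o).2 κ
                  (fun i => (((ofLex (ofLex (ofLex o).1).2 i : ℕ) + 2 * (if (ofLex (ofLex o).1).1 = 0 then (r i : ℕ) else
                    ((r i : ℕ) + 1) % q i) : ℕ) : ZMod (M i)))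
                  (fun i => (((ofLex (ofLex (ofLex o').1).2 i : ℕ) + 2 * (if (ofLex (ofLex o').1).1 = 0 then (r i : ℕ) else
                    ((r i : ℕ) + 1) % q i) : ℕ) : ZMod (M i))) else 0) =
      (Matrix.of fun o o' : Orb (Fin 2 ×ₗ FermionTorus 2 2) => if (ofLex o).2 = (ofLex o').2 then
              Γ (ofLex o).2 ((if (ofLex (ofLex o).1).1 = 0 then (0 : Fin 2 → ℤ) else
                    ((if (r 0 : ℕ) + 1 < q 0 then 0 else Pi.single 0 1) + (if (r 1 : ℕ) + 1 < q 1 then 0 else Pi.single 1 1))) -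
                  (if (ofLex (ofLex o').1).1 = 0 then (0 : Fin 2 → ℤ) else
                    ((if (r 0 : ℕ) + 1 < q 0 then 0 else Pi.single 0 1) + (if (r 1 : ℕ) + 1 < q 1 then 0 else Pi.single 1 1))))
                  (fun i => (((ofLex (ofLex (ofLex o).1).2 i : ℕ) + 2 * (if (ofLex (ofLex o).1).1 = 0 then (r i : ℕ) else
                    ((r i : ℕ) + 1) % q i) : ℕ) : ZMod (M i)))
                  (fun i => (((ofLex (ofLex (ofLex o').1).2 i : ℕ) + 2 * (if (ofLex (ofLex o').1).1 = 0 then (r i : ℕ) else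
                    ((r i : ℕ) + 1) % q i) : ℕ) : ZMod (M i))) else 0) := by
  ext o o'
  simp only [Matrix.of_apply]
  by_cases hσ : (ofLex o).2 = (ofLex o').2
  · rw [if_pos hσ, if_pos hσ]
    have hz : ∀ oo : Orb (Fin 2 ×ₗ FermionTorus 2 2), ∀ i,
        (if (ofLex (ofLex oo).1).1 = 0 then (0 : Fin 2 → ℤ) else
                    ((if (r 0 : ℕ) + 1 < q 0 then 0 else Pi.single 0 1) + (if (r 1 : ℕ) + 1 < q 1 then 0 else Pi.single 1 1))) i = 0 ∨
        (if (ofLex (ofLex oo).1).1 = 0 then (0 : Fin 2 → ℤ) else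
                    ((if (r 0 : ℕ) + 1 < q 0 then 0 else Pi.single 0 1) + (if (r 1 : ℕ) + 1 < q 1 then 0 else Pi.single 1 1))) i = 1 := by
      intro oo i
      fin_cases i <;> split_ifs <;> simp
    rw [← hΓ _ _ (sub_apply_mem_of_zero_one (hz o) (hz o'))]
    congr 1
    refine Finset.sum_congr rfl fun κ _ => ?_
    congr 2
    simp only [cellVec_sub', apply_ite (cellVec k), cellVec_add', cellVec_zero', cellVec_single']
  · rw [if_neg hσ, if_neg hσ]

omit [∀ i, NeZero (M i)] in
/-- **The corner window of kind `1` in harmonics**: with `Γ σ u = |k|⁻¹ Σ_κ χ_κ(u) Q σ κ` for `u ∈ {0,±1}²`, the window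
`W₁₆` of `Upper/BlochDressedCornerWindowsTTPrime.lean` has entries `Γ σ (z(o) − z(o'))`, `z` the integer cell-crossing vector of the copy.
[cite: BachLiebSolovej1994, eq. (3a.2)] -/
theorem cornerWindow_one_eq_harmonics
    (Q : Fin 2 → RectTorusSite k → Matrix (RectTorusSite M) (RectTorusSite M) ℂ)
    (Γ : Fin 2 → (Fin 2 → ℤ) → Matrix (RectTorusSite M) (RectTorusSite M) ℂ)
    (hΓ : ∀ σ (u : Fin 2 → ℤ), (∀ j, u j = 0 ∨ u j = 1 ∨ u j = -1) → ∀ p p',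
      ((Fintype.card (RectTorusSite k) : ℂ))⁻¹ * ∑ κ, blockChar κ (cellVec k u) * Q σ κ p p' = Γ σ u p p')
    (r : (i : Fin 2) → Fin (q i)) :
    (Matrix.of fun o o' : Orb (Fin 2 ×ₗ FermionTorus 2 2) => if (ofLex o).2 = (ofLex o').2 then
              ((Fintype.card (RectTorusSite k) : ℂ))⁻¹ * ∑ κ, blockChar κ
                ((if (ofLex (ofLex o).1).1 = 0 then (if (r 1 : ℕ) + 1 < q 1 then (0 : RectTorusSite k) else Pi.single 1 1) else
                    (if (r 0 : ℕ) + 1 < q 0 then (0 : RectTorusSite k) else Pi.single 0 1)) -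
                  (if (ofLex (ofLex o').1).1 = 0 then (if (r 1 : ℕ) + 1 < q 1 then (0 : RectTorusSite k) else Pi.single 1 1) else
                    (if (r 0 : ℕ) + 1 < q 0 then (0 : RectTorusSite k) else Pi.single 0 1))) *
                Q (ofLex o).2 κ
                  (fun i => (((ofLex (ofLex (ofLex o).1).2 i : ℕ) + 2 * (if i = (if (ofLex (ofLex o).1).1 = 0 then 1 else 0) then
                    ((r i : ℕ) + 1) % q i else (r i : ℕ)) : ℕ) : ZMod (M i)))
                  (fun i => (((ofLex (ofLex (ofLex o').1).2 i : ℕ) + 2 * (if i = (if (ofLex (ofLex o').1).1 = 0 then 1 else 0) then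
                    ((r i : ℕ) + 1) % q i else (r i : ℕ)) : ℕ) : ZMod (M i))) else 0) =
      (Matrix.of fun o o' : Orb (Fin 2 ×ₗ FermionTorus 2 2) => if (ofLex o).2 = (ofLex o').2 then
              Γ (ofLex o).2 ((if (ofLex (ofLex o).1).1 = 0 then (if (r 1 : ℕ) + 1 < q 1 then (0 : Fin 2 → ℤ) else Pi.single 1 1) else
                    (if (r 0 : ℕ) + 1 < q 0 then (0 : Fin 2 → ℤ) else Pi.single 0 1)) -
                  (if (ofLex (ofLex o').1).1 = 0 then (if (r 1 : ℕ) + 1 < q 1 then (0 : Fin 2 → ℤ) else Pi.single 1 1) else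
                    (if (r 0 : ℕ) + 1 < q 0 then (0 : Fin 2 → ℤ) else Pi.single 0 1)))
                  (fun i => (((ofLex (ofLex (ofLex o).1).2 i : ℕ) + 2 * (if i = (if (ofLex (ofLex o).1).1 = 0 then 1 else 0) then
                    ((r i : ℕ) + 1) % q i else (r i : ℕ)) : ℕ) : ZMod (M i)))
                  (fun i => (((ofLex (ofLex (ofLex o').1).2 i : ℕ) + 2 * (if i = (if (ofLex (ofLex o').1).1 = 0 then 1 else 0) then
                    ((r i : ℕ) + 1) % q i else (r i : ℕ)) : ℕ) : ZMod (M i))) else 0) := by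
  ext o o'
  simp only [Matrix.of_apply]
  by_cases hσ : (ofLex o).2 = (ofLex o').2
  · rw [if_pos hσ, if_pos hσ]
    have hz : ∀ oo : Orb (Fin 2 ×ₗ FermionTorus 2 2), ∀ i,
        (if (ofLex (ofLex oo).1).1 = 0 then (if (r 1 : ℕ) + 1 < q 1 then (0 : Fin 2 → ℤ) else Pi.single 1 1) else
                    (if (r 0 : ℕ) + 1 < q 0 then (0 : Fin 2 → ℤ) else Pi.single 0 1)) i = 0 ∨
        (if (ofLex (ofLex oo).1).1 = 0 then (if (r 1 : ℕ) + 1 < q 1 then (0 : Fin 2 → ℤ) else Pi.single 1 1) else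
                    (if (r 0 : ℕ) + 1 < q 0 then (0 : Fin 2 → ℤ) else Pi.single 0 1)) i = 1 := by
      intro oo i
      fin_cases i <;> split_ifs <;> simp
    rw [← hΓ _ _ (sub_apply_mem_of_zero_one (hz o) (hz o'))]
    congr 1
    refine Finset.sum_congr rfl fun κ _ => ?_
    congr 2
    simp only [cellVec_sub', apply_ite (cellVec k), cellVec_zero', cellVec_single']
  · rw [if_neg hσ, if_neg hσ]

end Harmonics

end Summit.Ventures.CertifiedManyBodySolver.Upper
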